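import Literature.MathematicalPhysics.QuantumFieldTheory.FiniteTemperatureTimeSiteRP
import Literature.MathematicalPhysics.QuantumFieldTheory.FiniteTemperaturePolyakovChessboard
import HarnessLib

/-!
# The Osterwalder–Schrader forms of the time and space SITE reflections on the finite-temperature lattice:
# Cauchy–Schwarz for finite families of observables

Topic `Literature/MathematicalPhysics/QuantumFieldTheory`; vocabulary of `Literature.Barriers.QuantumFields.FiniteTemperature*`
(Borgs–Seiler's lattice `ℤ_{L₀} × (ℤ/L)^d`, weight `weight ρ J_E J_M`, a-priori measure `haar`), of
`FiniteTemperatureTimeSiteRP.lean` (reflection positivity through the time slices `t = 0`, `t = L₀/2` for a general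
observable, `L₀` even) and of the tree's `FiniteTemperature.integral_mul_conj_spaceSiteReflect_mul_weight_nonneg`
(`FiniteTemperatureSpatialReflectionPositivity.lean`: reflection positivity through the spatial lattice planes `x_i = 0`,
`x_i = L/2`, `L = 2n + 2 ≥ 4`).  From single-observable positivity this file derives the CAUCHY–SCHWARZ inequality of the
Osterwalder–Schrader form on FINITE FAMILIES of observables,

  `B(F, G) = Σ_k ∫ F_k(U) conj G_k(ΘU) e^{-S(U)} ∏dg`,  `|B(F, G)|² ≤ B(F, F) · B(G, G)`,

the tool of the Tomboulis–Yaffe chain (Comm. Math. Phys. 100 (1985) 313, §II (2.5): "Applying the Schwarz inequality for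
sums gives …"; matrix-valued half-loops are families indexed by their entries):

* `OSForm.normSq_le` — the ABSTRACT statement: a probability space `(X, μ)`, a measure-preserving involution `θ`, a
  `θ`-invariant bounded measurable real weight `w`, bounded measurable families `F, G : ι → X → ℂ`; IF the form is
  non-negative on `F + cG` for every `c ∈ ℂ` and on `G`, THEN `|B(F,G)|² ≤ Re B(F,F) · Re B(G,G)` (Hermitian symmetry by
  the change of variables `U ↦ θU`, then the discriminant of `t ↦ B(F + tuG, F + tuG)`);
* ★ `time_osForm_normSq_le`, `time_osForm_self_nonneg` — the instance for the time reflection `timeReflect`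
  (`L₀ = 2m + 2`, families depending on `evenPos ∪ evenShared`);
* ★ `site_osForm_normSq_le`, `site_osForm_self_nonneg` — the instance for the spatial site reflection
  `spaceSiteReflect i` (`L = 2n + 2`, `n ≥ 1`, families depending on `sitePos ∪ siteShared`);
* `integral_comp_spaceSiteReflect'` — change of variables by the site reflection (vector-valued integrands).

Everything is proved; no definitions.  HONEST FRAMING: finite-volume inequalities at fixed couplings; nothing about limits,
confinement or a mass gap.

References: K. Osterwalder, E. Seiler, Ann. Phys. 110 (1978) 440, §2; E. Seiler, LNP 159 (1982) Ch. 2; E. T. Tomboulis,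
L. G. Yaffe, Commun. Math. Phys. 100 (1985) 313, §II (2.4)–(2.5); C. Borgs, E. Seiler, Commun. Math. Phys. 91 (1983) 329,
§II.2.
-/

noncomputable section

open MeasureTheory Filter Topology Finset
open scoped ComplexConjugate ComplexOrder BigOperators

/-! ### The abstract Cauchy–Schwarz inequality of a reflection form -/

namespace Literature.MathematicalPhysics.QuantumFieldTheory

namespace OSForm

variable {X : Type*} [MeasurableSpace X] (μ : Measure X) [IsProbabilityMeasure μ] (θ : X → X) (w : X → ℝ)
  {ι : Type*} [Fintype ι]

omit [Fintype ι] in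
/-- A product `f · g · w` of bounded measurable functions is integrable against the probability measure (plumbing).
[folklore] -/
private theorem integrable_triple {f g : X → ℂ} (hf : Measurable f) (hg : Measurable g) (hwm : Measurable w)
    {Kf Kg Kw : ℝ} (hfb : ∀ x, ‖f x‖ ≤ Kf) (hgb : ∀ x, ‖g x‖ ≤ Kg) (hwb : ∀ x, |w x| ≤ Kw) :
    Integrable (fun x => f x * g x * (w x : ℂ)) μ := by
  refine Integrable.of_bound ((hf.mul hg).mul (Complex.measurable_ofReal.comp hwm)).aestronglyMeasurable
    (|Kf| * |Kg| * |Kw|) (ae_of_all _ fun x => ?_)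
  rw [norm_mul, norm_mul, Complex.norm_real, Real.norm_eq_abs]
  exact mul_le_mul (mul_le_mul ((hfb x).trans (le_abs_self _)) ((hgb x).trans (le_abs_self _)) (norm_nonneg _)
    (abs_nonneg _)) ((hwb x).trans (le_abs_self _)) (abs_nonneg _) (mul_nonneg (abs_nonneg _) (abs_nonneg _))

omit [IsProbabilityMeasure μ] [Fintype ι] in
/-- Change of variables by a measure-preserving involution (plumbing). [folklore] -/
private theorem integral_comp_invol (hθ : MeasurePreserving θ μ μ) (hθθ : ∀ x, θ (θ x) = x) (g : X → ℂ) :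
    ∫ x, g (θ x) ∂μ = ∫ x, g x ∂μ := by
  let e : X ≃ᵐ X :=
    { toFun := θ, invFun := θ, left_inv := hθθ, right_inv := hθθ, measurable_toFun := hθ.measurable,
      measurable_invFun := hθ.measurable }
  have hmp : MeasurePreserving e μ μ := hθ
  exact hmp.integral_comp' g

omit [IsProbabilityMeasure μ] [Fintype ι] in
/-- **Hermitian symmetry of a reflection form**: for a measure-preserving involution `θ` and a `θ`-invariant real weight,
`∫ G conj(F ∘ θ) w = conj ∫ F conj(G ∘ θ) w`. [cite: SeilerLNP1982, Ch. 2] -/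
theorem integral_mul_conj_comp_symm (hθ : MeasurePreserving θ μ μ) (hθθ : ∀ x, θ (θ x) = x) (hw : ∀ x, w (θ x) = w x)
    (F G : X → ℂ) :
    ∫ x, G x * conj (F (θ x)) * (w x : ℂ) ∂μ = conj (∫ x, F x * conj (G (θ x)) * (w x : ℂ) ∂μ) := by
  rw [← integral_conj]
  have h := integral_comp_invol μ θ hθ hθθ (fun x => conj (F x * conj (G (θ x)) * (w x : ℂ)))
  rw [← h]
  refine integral_congr_ae (Eventually.of_forall fun x => ?_)
  simp only [hθθ, hw, map_mul, Complex.conj_conj, Complex.conj_ofReal]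
  ring

/-- **Cauchy–Schwarz for a reflection form (abstract).**  Let `θ` be a measure-preserving involution of the probability
space `(X, μ)`, `w` a bounded measurable real `θ`-invariant weight, and `F, G : ι → X → ℂ` bounded measurable families.
If `Σ_k ∫ H_k conj(H_k ∘ θ) w ≥ 0` for `H = F + cG` (every `c ∈ ℂ`) and for `H = G`, then
`|Σ_k ∫ F_k conj(G_k ∘ θ) w|² ≤ Re(Σ_k ∫ F_k conj(F_k ∘ θ) w) · Re(Σ_k ∫ G_k conj(G_k ∘ θ) w)`.
("Applying the Schwarz inequality for sums gives …")
[cite: TomboulisYaffe1985, §II.A eq. (2.5) (p. 315)] [cite: SeilerLNP1982, Ch. 2] -/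
theorem normSq_le (hθ : MeasurePreserving θ μ μ) (hθθ : ∀ x, θ (θ x) = x) (hw : ∀ x, w (θ x) = w x)
    (hwm : Measurable w) {Kw : ℝ} (hwb : ∀ x, |w x| ≤ Kw)
    (F G : ι → X → ℂ) (hFm : ∀ k, Measurable (F k)) (hGm : ∀ k, Measurable (G k)) {KF KG : ℝ}
    (hFb : ∀ k x, ‖F k x‖ ≤ KF) (hGb : ∀ k x, ‖G k x‖ ≤ KG)
    (hRP : ∀ c : ℂ, 0 ≤ ∑ k, ∫ x, (F k x + c * G k x) * conj (F k (θ x) + c * G k (θ x)) * (w x : ℂ) ∂μ)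
    (hRPG : 0 ≤ ∑ k, ∫ x, G k x * conj (G k (θ x)) * (w x : ℂ) ∂μ) :
    ‖∑ k, ∫ x, F k x * conj (G k (θ x)) * (w x : ℂ) ∂μ‖ ^ 2 ≤
      (∑ k, ∫ x, F k x * conj (F k (θ x)) * (w x : ℂ) ∂μ).re *
        (∑ k, ∫ x, G k x * conj (G k (θ x)) * (w x : ℂ) ∂μ).re := by
  have hθm : Measurable θ := hθ.measurable
  have hconj : Measurable (starRingEnd ℂ : ℂ → ℂ) := Complex.continuous_conj.measurable
  set A : ℂ := ∑ k, ∫ x, F k x * conj (F k (θ x)) * (w x : ℂ) ∂μ with hA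
  set B : ℂ := ∑ k, ∫ x, F k x * conj (G k (θ x)) * (w x : ℂ) ∂μ with hB
  set B' : ℂ := ∑ k, ∫ x, G k x * conj (F k (θ x)) * (w x : ℂ) ∂μ with hB'
  set C : ℂ := ∑ k, ∫ x, G k x * conj (G k (θ x)) * (w x : ℂ) ∂μ with hC
  -- integrability of the four kinds of terms
  have hiFF : ∀ k, Integrable (fun x => F k x * conj (F k (θ x)) * (w x : ℂ)) μ := fun k =>
    integrable_triple μ w (hFm k) (hconj.comp ((hFm k).comp hθm)) hwm (hFb k)
      (fun x => by rw [Complex.norm_conj]; exact hFb k _) hwb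
  have hiFG : ∀ k, Integrable (fun x => F k x * conj (G k (θ x)) * (w x : ℂ)) μ := fun k =>
    integrable_triple μ w (hFm k) (hconj.comp ((hGm k).comp hθm)) hwm (hFb k)
      (fun x => by rw [Complex.norm_conj]; exact hGb k _) hwb
  have hiGF : ∀ k, Integrable (fun x => G k x * conj (F k (θ x)) * (w x : ℂ)) μ := fun k =>
    integrable_triple μ w (hGm k) (hconj.comp ((hFm k).comp hθm)) hwm (hGb k)
      (fun x => by rw [Complex.norm_conj]; exact hFb k _) hwb
  have hiGG : ∀ k, Integrable (fun x => G k x * conj (G k (θ x)) * (w x : ℂ)) μ := fun k =>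
    integrable_triple μ w (hGm k) (hconj.comp ((hGm k).comp hθm)) hwm (hGb k)
      (fun x => by rw [Complex.norm_conj]; exact hGb k _) hwb
  -- expansion of the form on `F + cG`
  have hexp : ∀ c : ℂ, ∑ k, ∫ x, (F k x + c * G k x) * conj (F k (θ x) + c * G k (θ x)) * (w x : ℂ) ∂μ =
      A + conj c * B + c * B' + c * conj c * C := by
    intro c
    have hpt : ∀ k, (fun x => (F k x + c * G k x) * conj (F k (θ x) + c * G k (θ x)) * (w x : ℂ)) =
        fun x => F k x * conj (F k (θ x)) * (w x : ℂ) + conj c * (F k x * conj (G k (θ x)) * (w x : ℂ)) +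
          c * (G k x * conj (F k (θ x)) * (w x : ℂ)) + c * conj c * (G k x * conj (G k (θ x)) * (w x : ℂ)) := by
      intro k; funext x; simp only [map_add, map_mul]; ring
    have hk : ∀ k, ∫ x, (F k x + c * G k x) * conj (F k (θ x) + c * G k (θ x)) * (w x : ℂ) ∂μ =
        (∫ x, F k x * conj (F k (θ x)) * (w x : ℂ) ∂μ) + conj c * (∫ x, F k x * conj (G k (θ x)) * (w x : ℂ) ∂μ) +
          c * (∫ x, G k x * conj (F k (θ x)) * (w x : ℂ) ∂μ) +
            c * conj c * (∫ x, G k x * conj (G k (θ x)) * (w x : ℂ) ∂μ) := by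
      intro k
      rw [hpt k, integral_add, integral_add, integral_add, integral_const_mul, integral_const_mul,
        integral_const_mul]
      · exact hiFF k
      · exact (hiFG k).const_mul _
      · exact (hiFF k).add ((hiFG k).const_mul _)
      · exact (hiGF k).const_mul _
      · exact ((hiFF k).add ((hiFG k).const_mul _)).add ((hiGF k).const_mul _)
      · exact (hiGG k).const_mul _
    simp_rw [hk]
    rw [Finset.sum_add_distrib, Finset.sum_add_distrib, Finset.sum_add_distrib, ← Finset.mul_sum, ← Finset.mul_sum,
      ← Finset.mul_sum]
  -- Hermitian symmetry
  have hsymm : B' = conj B := by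
    rw [hB', hB, map_sum]
    exact Finset.sum_congr rfl fun k _ => integral_mul_conj_comp_symm μ θ w hθ hθθ hw (F k) (G k)
  -- the diagonal values are non-negative reals
  have hA0 : 0 ≤ A := by
    have h := hRP 0
    simp only [zero_mul, add_zero] at h
    exact h
  have hAre : 0 ≤ A.re := (Complex.nonneg_iff.1 hA0).1
  have hCre : 0 ≤ C.re := (Complex.nonneg_iff.1 hRPG).1
  by_cases hB0 : B = 0
  · rw [hB0, norm_zero, zero_pow two_ne_zero]
    exact mul_nonneg hAre hCre
  -- the discriminant of `t ↦ B(F + tuG, F + tuG)`, `u = B / |B|`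
  have hnB : (‖B‖ : ℂ) ≠ 0 := by exact_mod_cast norm_ne_zero_iff.2 hB0
  set u : ℂ := B / (‖B‖ : ℂ) with hu
  have hBB : B * conj B = (‖B‖ : ℂ) ^ 2 := by
    rw [Complex.mul_conj, Complex.normSq_eq_norm_sq]; push_cast; ring
  have key : ∀ t : ℝ, A + conj ((t : ℂ) * u) * B + ((t : ℂ) * u) * B' + ((t : ℂ) * u) * conj ((t : ℂ) * u) * C =
      A + ((2 * t * ‖B‖ : ℝ) : ℂ) + ((t ^ 2 : ℝ) : ℂ) * C := by
    intro t
    rw [hsymm]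
    have h1 : conj ((t : ℂ) * u) * B = ((t * ‖B‖ : ℝ) : ℂ) := by
      rw [hu, map_mul, Complex.conj_ofReal, map_div₀, Complex.conj_ofReal]
      have : conj B * B = (‖B‖ : ℂ) ^ 2 := by rw [mul_comm, hBB]
      push_cast
      field_simp
      linear_combination (t : ℂ) * this
    have h2 : ((t : ℂ) * u) * conj B = ((t * ‖B‖ : ℝ) : ℂ) := by
      rw [hu]
      push_cast
      field_simp
      linear_combination (t : ℂ) * hBB
    have h3 : ((t : ℂ) * u) * conj ((t : ℂ) * u) = ((t ^ 2 : ℝ) : ℂ) := by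
      rw [hu, map_mul, Complex.conj_ofReal, map_div₀, Complex.conj_ofReal]
      push_cast
      field_simp
      linear_combination (t : ℂ) ^ 2 * hBB
    rw [h1, h2, h3]
    push_cast
    ring
  have hquad : ∀ t : ℝ, 0 ≤ C.re * (t * t) + 2 * ‖B‖ * t + A.re := by
    intro t
    have h := hRP ((t : ℂ) * u)
    rw [hexp, key] at h
    have hre := (Complex.nonneg_iff.1 h).1
    simp only [Complex.add_re, Complex.ofReal_re, Complex.re_ofReal_mul] at hre
    nlinarith [hre]
  have hdisc := discrim_le_zero hquad
  rw [discrim] at hdisc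
  nlinarith [hdisc, norm_nonneg B]

end OSForm

end Literature.MathematicalPhysics.QuantumFieldTheory

/-! ### The instances on the finite-temperature lattice -/

namespace Literature.Barriers.QuantumFields

namespace FiniteTemperature

open Literature.MathematicalPhysics.QuantumFieldTheory
open Literature.MathematicalPhysics.QuantumFieldTheory.TomboulisYaffeHighTemperature
  (weight_spaceSiteReflect spaceSiteReflect_spaceSiteReflect)

section Time

variable {d m L : ℕ} [NeZero L] {G : Type*} [Group G] [TopologicalSpace G] [IsTopologicalGroup G]
  [CompactSpace G] [MeasurableSpace G] [BorelSpace G] [SecondCountableTopology G] {N : ℕ}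
variable (ρ : G →* Matrix (Fin N) (Fin N) ℂ) {ι : Type*} [Fintype ι]

/-- **Positivity of the time-reflection form on a family** (`L₀ = 2m + 2`): `0 ≤ Σ_k ∫ F_k conj(F_k ∘ θ) e^{-S}` for
bounded measurable `F_k` depending on `evenPos ∪ evenShared`. [cite: TomboulisYaffe1985, §II.A eq. (2.4) (p. 315)] -/
theorem time_osForm_self_nonneg (hρu : ∀ g, ρ g ∈ Matrix.unitaryGroup (Fin N) ℂ) (hρ : Continuous ρ) (JE JM : ℝ)
    (F : ι → Config d (2 * m + 2) L G → ℂ) (hFm : ∀ k, Measurable (F k)) {KF : ℝ} (hFb : ∀ k U, ‖F k U‖ ≤ KF)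
    (hFd : ∀ k, DependsOn (F k) ((evenPos d m L ∪ ∅ ∪ evenShared d m L : Finset _) : Set _)) :
    0 ≤ ∑ k, ∫ U, F k U * conj (F k (timeReflect U)) * (weight ρ JE JM U : ℂ) ∂haar d (2 * m + 2) L G :=
  Finset.sum_nonneg fun k _ => integral_mul_conj_timeReflect_mul_weight_nonneg ρ hρu hρ JE JM (hFm k) (hFb k) (hFd k)

/-- **★ Cauchy–Schwarz of the time-reflection form on families** (`L₀ = 2m + 2`, any real `J_E, J_M`):
`|Σ_k ∫ F_k conj(G_k ∘ θ) e^{-S}|² ≤ Re(Σ_k ∫ F_k conj(F_k ∘ θ) e^{-S}) · Re(Σ_k ∫ G_k conj(G_k ∘ θ) e^{-S})` for bounded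
measurable families depending on the closed positive half `evenPos ∪ evenShared`.
[cite: TomboulisYaffe1985, §II.A eq. (2.5) (p. 315)] [cite: BorgsSeiler1983, §II.2 (pp. 331–332)] -/
theorem time_osForm_normSq_le (hρu : ∀ g, ρ g ∈ Matrix.unitaryGroup (Fin N) ℂ) (hρ : Continuous ρ) (JE JM : ℝ)
    (F G' : ι → Config d (2 * m + 2) L G → ℂ) (hFm : ∀ k, Measurable (F k)) (hGm : ∀ k, Measurable (G' k))
    {KF KG : ℝ} (hFb : ∀ k U, ‖F k U‖ ≤ KF) (hGb : ∀ k U, ‖G' k U‖ ≤ KG)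
    (hFd : ∀ k, DependsOn (F k) ((evenPos d m L ∪ ∅ ∪ evenShared d m L : Finset _) : Set _))
    (hGd : ∀ k, DependsOn (G' k) ((evenPos d m L ∪ ∅ ∪ evenShared d m L : Finset _) : Set _)) :
    ‖∑ k, ∫ U, F k U * conj (G' k (timeReflect U)) * (weight ρ JE JM U : ℂ) ∂haar d (2 * m + 2) L G‖ ^ 2 ≤
      (∑ k, ∫ U, F k U * conj (F k (timeReflect U)) * (weight ρ JE JM U : ℂ) ∂haar d (2 * m + 2) L G).re *
        (∑ k, ∫ U, G' k U * conj (G' k (timeReflect U)) * (weight ρ JE JM U : ℂ) ∂haar d (2 * m + 2) L G).re := by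
  have hwc := continuous_weight (d := d) (L₀ := 2 * m + 2) (L := L) ρ hρ JE JM
  obtain ⟨Kw, hKw⟩ := exists_forall_norm_le_of_continuous (L := L) hwc
  have hK0 : ∀ c : ℂ, ∀ k U, ‖F k U + c * G' k U‖ ≤ KF + ‖c‖ * KG := fun c k U =>
    (norm_add_le _ _).trans (add_le_add (hFb k U)
      ((norm_mul c _).le.trans (mul_le_mul_of_nonneg_left (hGb k U) (norm_nonneg c))))
  refine OSForm.normSq_le (haar d (2 * m + 2) L G) timeReflect (weight ρ JE JM) measurePreserving_timeReflect
    timeReflect_timeReflect (weight_timeReflect ρ hρu JE JM) hwc.measurable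
    (fun U => by rw [← Real.norm_eq_abs]; exact hKw U) F G' hFm hGm hFb hGb (fun c => ?_) ?_
  · exact time_osForm_self_nonneg ρ hρu hρ JE JM (fun k U => F k U + c * G' k U)
      (fun k => (hFm k).add (measurable_const.mul (hGm k))) (hK0 c)
      (fun k U V hUV => by simp only [hFd k hUV, hGd k hUV])
  · exact time_osForm_self_nonneg ρ hρu hρ JE JM G' hGm hGb hGd

end Time

section Site

variable {d L₀ n : ℕ} [NeZero L₀] {G : Type*} [Group G] [TopologicalSpace G] [IsTopologicalGroup G]
  [CompactSpace G] [MeasurableSpace G] [BorelSpace G] [SecondCountableTopology G] {N : ℕ}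
variable (ρ : G →* Matrix (Fin N) (Fin N) ℂ) {ι : Type*} [Fintype ι]

omit [SecondCountableTopology G] [Fintype ι] ρ in
/-- Change of variables by the spatial site reflection: `∫ f(σU) ∏dg = ∫ f(U) ∏dg` (vector-valued integrands).
[cite: BorgsSeiler1983, §II.2 (pp. 331–332)] -/
theorem integral_comp_spaceSiteReflect' {L : ℕ} [NeZero L] {E : Type*} [NormedAddCommGroup E] [NormedSpace ℝ E]
    (i : Fin d) (f : Config d L₀ L G → E) :
    ∫ U, f (spaceSiteReflect i U) ∂haar d L₀ L G = ∫ U, f U ∂haar d L₀ L G := by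
  have hm := (measurePreserving_spaceSiteReflect (d := d) (L₀ := L₀) (L := L) (G := G) i).measurable
  let e : Config d L₀ L G ≃ᵐ Config d L₀ L G :=
    { toFun := spaceSiteReflect i, invFun := spaceSiteReflect i, left_inv := fun U => spaceSiteReflect_spaceSiteReflect i U,
      right_inv := fun U => spaceSiteReflect_spaceSiteReflect i U, measurable_toFun := hm, measurable_invFun := hm }
  have hmp : MeasurePreserving e (haar d L₀ L G) (haar d L₀ L G) := measurePreserving_spaceSiteReflect i
  exact hmp.integral_comp' f

/-- **Positivity of the site-reflection form on a family** (`L = 2n + 2`, `n ≥ 1`): `0 ≤ Σ_k ∫ F_k conj(F_k ∘ σ) e^{-S}`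
for bounded measurable `F_k` depending on `sitePos ∪ siteShared`. [cite: TomboulisYaffe1985, §II.A eq. (2.4) (p. 315)] -/
theorem site_osForm_self_nonneg (hρu : ∀ g, ρ g ∈ Matrix.unitaryGroup (Fin N) ℂ) (hρ : Continuous ρ) (hn : 1 ≤ n)
    (JE JM : ℝ) (i : Fin d) (F : ι → Config d L₀ (2 * n + 2) G → ℂ) (hFm : ∀ k, Measurable (F k)) {KF : ℝ}
    (hFb : ∀ k U, ‖F k U‖ ≤ KF)
    (hFd : ∀ k, DependsOn (F k) ((sitePos d L₀ n i ∪ ∅ ∪ siteShared d L₀ n i : Finset _) : Set _)) :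
    0 ≤ ∑ k, ∫ U, F k U * conj (F k (spaceSiteReflect i U)) * (weight ρ JE JM U : ℂ) ∂haar d L₀ (2 * n + 2) G :=
  Finset.sum_nonneg fun k _ =>
    integral_mul_conj_spaceSiteReflect_mul_weight_nonneg ρ hρu hρ hn JE JM i (hFm k) (hFb k) (hFd k)

/-- **★ Cauchy–Schwarz of the site-reflection form on families** (`L = 2n + 2`, `n ≥ 1`, any real `J_E, J_M`):
`|Σ_k ∫ F_k conj(G_k ∘ σ) e^{-S}|² ≤ Re(Σ_k ∫ F_k conj(F_k ∘ σ) e^{-S}) · Re(Σ_k ∫ G_k conj(G_k ∘ σ) e^{-S})` for bounded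
measurable families depending on the closed positive half `sitePos ∪ siteShared` of the direction `i`.
[cite: TomboulisYaffe1985, §II.A eq. (2.5) (p. 315)] [cite: BorgsSeiler1983, §II.2 (pp. 331–332)] -/
theorem site_osForm_normSq_le (hρu : ∀ g, ρ g ∈ Matrix.unitaryGroup (Fin N) ℂ) (hρ : Continuous ρ) (hn : 1 ≤ n)
    (JE JM : ℝ) (i : Fin d) (F G' : ι → Config d L₀ (2 * n + 2) G → ℂ) (hFm : ∀ k, Measurable (F k))
    (hGm : ∀ k, Measurable (G' k)) {KF KG : ℝ} (hFb : ∀ k U, ‖F k U‖ ≤ KF) (hGb : ∀ k U, ‖G' k U‖ ≤ KG)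
    (hFd : ∀ k, DependsOn (F k) ((sitePos d L₀ n i ∪ ∅ ∪ siteShared d L₀ n i : Finset _) : Set _))
    (hGd : ∀ k, DependsOn (G' k) ((sitePos d L₀ n i ∪ ∅ ∪ siteShared d L₀ n i : Finset _) : Set _)) :
    ‖∑ k, ∫ U, F k U * conj (G' k (spaceSiteReflect i U)) * (weight ρ JE JM U : ℂ) ∂haar d L₀ (2 * n + 2) G‖ ^ 2 ≤
      (∑ k, ∫ U, F k U * conj (F k (spaceSiteReflect i U)) * (weight ρ JE JM U : ℂ) ∂haar d L₀ (2 * n + 2) G).re *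
        (∑ k, ∫ U, G' k U * conj (G' k (spaceSiteReflect i U)) * (weight ρ JE JM U : ℂ)
          ∂haar d L₀ (2 * n + 2) G).re := by
  have hwc := continuous_weight (d := d) (L₀ := L₀) (L := 2 * n + 2) ρ hρ JE JM
  obtain ⟨Kw, hKw⟩ := exists_forall_norm_le_of_continuous (L := 2 * n + 2) hwc
  have hK0 : ∀ c : ℂ, ∀ k U, ‖F k U + c * G' k U‖ ≤ KF + ‖c‖ * KG := fun c k U =>
    (norm_add_le _ _).trans (add_le_add (hFb k U)
      ((norm_mul c _).le.trans (mul_le_mul_of_nonneg_left (hGb k U) (norm_nonneg c))))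
  refine OSForm.normSq_le (haar d L₀ (2 * n + 2) G) (spaceSiteReflect i) (weight ρ JE JM)
    (measurePreserving_spaceSiteReflect i) (spaceSiteReflect_spaceSiteReflect i) (weight_spaceSiteReflect ρ hρu JE JM i)
    hwc.measurable (fun U => by rw [← Real.norm_eq_abs]; exact hKw U) F G' hFm hGm hFb hGb (fun c => ?_) ?_
  · exact site_osForm_self_nonneg ρ hρu hρ hn JE JM i (fun k U => F k U + c * G' k U)
      (fun k => (hFm k).add (measurable_const.mul (hGm k))) (hK0 c)
      (fun k U V hUV => by simp only [hFd k hUV, hGd k hUV])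
  · exact site_osForm_self_nonneg ρ hρu hρ hn JE JM i G' hGm hGb hGd

end Site

end FiniteTemperature

end Literature.Barriers.QuantumFields

end
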